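import Literature.NumberTheory.Deninger2022.ArithmeticCohomology

/-!
# Deninger's complete package (2.5) ∧ (2.6) ∧ (2.7) on a diagonal carrier: the signed partner twist (motivic door, cc-4 gen 3, part 1 — generic)

`Literature.NumberTheory.Deninger2022` types C. Deninger's axioms for a would-be cohomology
`H¹ = H¹(Spec ℤ̄, 𝒞)` with "Frobenius generator" `θ` (arXiv:2204.02714 §2): (2.3) `SpectrumAxiom θ`,
(2.5) `CupLeibniz θ C` (`C(θh₁,h₂) + C(h₁,θh₂) = C(h₁,h₂)`, `C = tr ∘ ∪`), (2.6) `CupPerfect θ C`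
(`∪ : H^{θ∼α} × H^{θ∼1-α} → ℂ` perfect) and (2.7) `HodgeStar θ C ∗ B` (an anti-linear `∗` with
`∗² = -1`, `∗θ = θ∗`, and `B(h,h') = C(h,∗h')` a scalar product), and proves Serre's argument
`SpectrumAxiom θ → Polarized θ B → RiemannHypothesis` and `CupLeibniz → HodgeStar → Polarized`.
So far the tree showed only that the SHORT list (2.3) ∧ (2.7′) is RH-equivalent
(`Theorems/MotivicDoorDeningerSpectrumModel.lean`).

This file constructs, for ANY operator `θ` diagonal in the standard basis of `ι →₀ ℂ` with weights
`w` (`θ f i = w i * f i`), any involution `σ` of `ι` exchanging the weight fibres of `α` and `1 - α`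
(`w (σ i) = 1 - w i`) and any sign `s = ±1` odd under `σ` (`s (σ i) = -s i`), the remaining objects
of Deninger's list — the **signed partner twist** —

* `cup σ s`   : `C(f,g) = Σ_k f(k) s(k) g(σk)`              (bilinear; alternating, `cup_swap`),
* `hodge σ s` : `(∗g)(j) = s(σj) · conj (g(σj))`            (anti-linear),
* `form σ s`  : `B(f,g) := C(f,∗g) = Σ_k f(k) conj (g(k))`  (the standard Hermitian form),

and proves, sorry-free and UNCONDITIONALLY in the weights: (2.1) `C` alternating (`cup_swap`);
(2.5) `cupLeibniz_of_diag`; (2.6) `cupPerfect_of_diag`; `∗∗ = -id` (`hodge_hodge`); `B = C(·,∗·)`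
Hermitian positive definite (`form_apply'`, `form_conj_symm`, `posDef_form`); while the ONE remaining
clause of (2.7), the `θ`-equivariance of `∗`, is EQUIVALENT to a condition on the weights:

  `(∀ g, ∗(θg) = θ(∗g)) ↔ ∀ j, conj (w (σ j)) = w j`                        (`hodge_comm_iff`),
  `HodgeStar θ (cup σ s) (hodge σ s) (form σ s) ↔ ∀ j, conj (w (σ j)) = w j`  (`hodgeStar_iff`),

i.e. with `w ∘ σ = 1 - w`: `Re (w j) = 1/2` for all `j`.  Part 2
(`Theorems/MotivicDoorDeningerPartner.lean`) builds `σ`, `s` on the multiplicity index set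
`Σ α, Fin (m α)` from `m(1-ρ) = m(ρ)` and `Im ρ ≠ 0` and shows the weight condition there is EXACTLY
the Riemann Hypothesis; part 3 (`Theorems/MotivicDoorDeningerHodgePackage.lean`) instantiates
`θ = diag weight` of the spectrum model, where (2.3) holds too.

Reading for the cell's located-gap entry (HOME/LOCATED-GAP.md §cc-4, ruling G11): within Deninger's
COMPLETE typed list every clause except one is bookkeeping realisable from the zero multiset with
its involutions `ρ ↦ 1-ρ`, `ρ ↦ ρ̄` and the sign of `Im ρ`; the clause that carries RH is `∗θ = θ∗`
— in Deninger's dynamical dictionary (Jber. DMV 103 (2001) = arXiv:math/0204110, proof of Thm 2.1)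
the CONFORMALITY (`α = 1`) of the flow for the leafwise metric defining `∗`.  A future construction
of `(H¹, θ, ∪, ∗)` can be checked clause by clause against `hodgeStar_iff`.

Honest grade: a reformulation; linear algebra and bookkeeping only; nothing here constructs a
geometric carrier.  Labels: every `theorem` PROVED (kernel); Deninger's axioms enter only as the
typed `Prop`s of `Literature.NumberTheory.Deninger2022`.
References: C. Deninger, arXiv:2204.02714 §2 (2.1)–(2.7); C. Deninger, arXiv:math/0204110 §2 Thm 2.1;
J.-P. Serre, Ann. of Math. 71 (1960) 392–394.
-/

set_option linter.dupNamespace false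

noncomputable section

open Complex Module Module.End
open Literature.NumberTheory.LFunctions Literature.NumberTheory.Deninger2022

namespace Summit.RiemannHypothesis.RiemannHypothesis.Theorems.MotivicDoor.DeningerHodgeTwist

variable {ι : Type}

/-! ## Generic constructions on `ι →₀ ℂ`: conjugation, signed twist, cup form, Hodge star, scalar product -/

/-- Coordinatewise complex conjugation on `ι →₀ ℂ`, a conjugate-linear map. -/
def conjF : (ι →₀ ℂ) →ₗ⋆[ℂ] (ι →₀ ℂ) where
  toFun g := Finsupp.mapRange (starRingEnd ℂ) (map_zero _) g
  map_add' f g := by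
    ext i
    simp
  map_smul' c g := by
    ext i
    simp

/-- `conjF` conjugates each coordinate. -/
@[simp] theorem conjF_apply (g : ι →₀ ℂ) (i : ι) : conjF g i = starRingEnd ℂ (g i) := rfl

/-- The signed twist `g ↦ (k ↦ s(k) · (σ_* g)(k))`; for an involution `σ` this is
`k ↦ s(k) · g(σ k)` (`twist_apply`). -/
def twist (σ : ι → ι) (s : ι → ℂ) : (ι →₀ ℂ) →ₗ[ℂ] (ι →₀ ℂ) where
  toFun g := Finsupp.onFinset (Finsupp.mapDomain σ g).support
      (fun k => s k * Finsupp.mapDomain σ g k) (by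
        intro k hk
        rw [Finsupp.mem_support_iff]
        intro h0
        exact hk (by rw [h0, mul_zero]))
  map_add' f g := by
    ext k
    simp only [Finsupp.onFinset_apply, Finsupp.add_apply, Finsupp.mapDomain_add, mul_add]
  map_smul' c g := by
    ext k
    simp only [Finsupp.onFinset_apply, Finsupp.smul_apply, Finsupp.mapDomain_smul, smul_eq_mul,
      RingHom.id_apply, mul_left_comm]

/-- Unfolding the signed twist. -/
theorem twist_apply' (σ : ι → ι) (s : ι → ℂ) (g : ι →₀ ℂ) (k : ι) :
    twist σ s g k = s k * Finsupp.mapDomain σ g k := rfl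

/-- Push-forward along an involution is pull-back. -/
theorem mapDomain_apply_of_involutive {σ : ι → ι} (hσ : Function.Involutive σ) (g : ι →₀ ℂ)
    (k : ι) : Finsupp.mapDomain σ g k = g (σ k) := by
  have h := Finsupp.mapDomain_apply hσ.injective g (σ k)
  rwa [hσ k] at h

/-- For an involution `σ`: `(twist σ s g)(k) = s(k) · g(σ k)`. -/
theorem twist_apply {σ : ι → ι} (hσ : Function.Involutive σ) (s : ι → ℂ) (g : ι →₀ ℂ) (k : ι) :
    twist σ s g k = s k * g (σ k) := by
  rw [twist_apply', mapDomain_apply_of_involutive hσ]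

/-- The would-be `C = tr ∘ ∪ : H¹ × H¹ → ℂ` of the signed partner twist:
`C(f,g) = Σ_k f(k) · s(k) · g(σ k)` (bilinear). -/
def cup (σ : ι → ι) (s : ι → ℂ) : (ι →₀ ℂ) →ₗ[ℂ] (ι →₀ ℂ) →ₗ[ℂ] ℂ :=
  LinearMap.mk₂ ℂ (fun f g => f.sum fun k a => a * (s k * g (σ k)))
    (fun f₁ f₂ g => Finsupp.sum_add_index' (fun k => zero_mul _) (fun k a b => add_mul _ _ _))
    (fun c f g => by
      rw [Finsupp.sum_smul_index' (fun k => zero_mul _), Finsupp.smul_sum]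
      simp only [smul_eq_mul, mul_assoc])
    (fun f g₁ g₂ => by
      simp only [Finsupp.sum, Finsupp.add_apply, mul_add, Finset.sum_add_distrib])
    (fun c f g => by
      simp only [Finsupp.sum, Finsupp.smul_apply, smul_eq_mul, Finset.mul_sum]
      exact Finset.sum_congr rfl (fun k _ => by ring))

/-- Unfolding the cup form. -/
@[simp] theorem cup_apply (σ : ι → ι) (s : ι → ℂ) (f g : ι →₀ ℂ) :
    cup σ s f g = ∑ k ∈ f.support, f k * (s k * g (σ k)) := rfl

/-- The cup form may be summed over any finite set containing the support of the first argument. -/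
theorem cup_eq_sum (σ : ι → ι) (s : ι → ℂ) {f : ι →₀ ℂ} (g : ι →₀ ℂ) {S : Finset ι}
    (hS : f.support ⊆ S) : cup σ s f g = ∑ k ∈ S, f k * (s k * g (σ k)) := by
  rw [cup_apply]
  exact Finset.sum_subset hS (fun k _ hk => by rw [Finsupp.notMem_support_iff.mp hk, zero_mul])

/-- **The cup form is alternating** (graded commutativity (2.1) on `H¹`: `h₁ ∪ h₂ = -h₂ ∪ h₁`),
because the sign `s` is odd under the involution `σ`; this is what the sign is for (with `s ≡ 1`
the form would be symmetric and `∗∗ = +1`). -/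
theorem cup_swap {σ : ι → ι} (hσ : Function.Involutive σ) {s : ι → ℂ} (hsσ : ∀ i, s (σ i) = -s i)
    (f g : ι →₀ ℂ) : cup σ s g f = -cup σ s f g := by
  classical
  set T : Finset ι := f.support ∪ g.support with hT
  set S : Finset ι := T ∪ T.map ⟨σ, hσ.injective⟩ with hS
  have hσS : ∀ k ∈ S, σ k ∈ S := by
    intro k hk
    rcases Finset.mem_union.mp hk with h | h
    · exact Finset.mem_union_right _ (Finset.mem_map.mpr ⟨k, h, rfl⟩)
    · obtain ⟨a, ha, hak⟩ := Finset.mem_map.mp h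
      have hk' : σ k = a := by rw [← hak]; exact hσ a
      rw [hk']
      exact Finset.mem_union_left _ ha
  have hfS : f.support ⊆ S := Finset.subset_union_left.trans Finset.subset_union_left
  have hgS : g.support ⊆ S := Finset.subset_union_right.trans Finset.subset_union_left
  rw [cup_eq_sum σ s f hgS, cup_eq_sum σ s g hfS, ← Finset.sum_neg_distrib]
  refine Finset.sum_nbij' σ σ hσS hσS (fun k _ => hσ k) (fun k _ => hσ k) (fun k _ => ?_)
  rw [hσ k, hsσ k]
  ring

/-- The would-be Hodge star of the signed partner twist: `(∗g)(j) = s(σ j) · conj (g(σ j))`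
(conjugate-linear). -/
def hodge (σ : ι → ι) (s : ι → ℂ) : (ι →₀ ℂ) →ₗ⋆[ℂ] (ι →₀ ℂ) := (twist σ (s ∘ σ)).comp conjF

/-- Unfolding the Hodge star (for an involution `σ`). -/
theorem hodge_apply {σ : ι → ι} (hσ : Function.Involutive σ) (s : ι → ℂ) (g : ι →₀ ℂ) (j : ι) :
    hodge σ s g j = s (σ j) * starRingEnd ℂ (g (σ j)) := by
  simp only [hodge, LinearMap.comp_apply, twist_apply hσ, Function.comp_apply, conjF_apply]

/-- **`∗∗ = -id`** (first clause of (2.7)), from `s = ±1` odd under the involution `σ`. -/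
theorem hodge_hodge {σ : ι → ι} (hσ : Function.Involutive σ) {s : ι → ℂ}
    (hs : ∀ i, s i = 1 ∨ s i = -1) (hsσ : ∀ i, s (σ i) = -s i) (g : ι →₀ ℂ) :
    hodge σ s (hodge σ s g) = -g := by
  ext j
  rw [hodge_apply hσ, hodge_apply hσ, hσ j, Finsupp.neg_apply, map_mul, Complex.conj_conj, hsσ j]
  rcases hs j with h | h <;> simp [h]

/-- **`C(f,∗g)` is the standard Hermitian form** `Σ_k f(k) conj (g(k))`, from `s = ±1`. -/
theorem cup_hodge {σ : ι → ι} (hσ : Function.Involutive σ) {s : ι → ℂ}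
    (hs : ∀ i, s i = 1 ∨ s i = -1) (f g : ι →₀ ℂ) :
    cup σ s f (hodge σ s g) = ∑ k ∈ f.support, f k * starRingEnd ℂ (g k) := by
  rw [cup_apply]
  refine Finset.sum_congr rfl (fun k _ => ?_)
  rw [hodge_apply hσ, hσ k]
  rcases hs k with h | h <;> simp [h]

/-- The would-be scalar product `B(h,h') := C(h,∗h')` of (2.7) (linear in `h`, anti-linear in `h'`). -/
def form (σ : ι → ι) (s : ι → ℂ) : (ι →₀ ℂ) →ₗ[ℂ] (ι →₀ ℂ) →ₗ⋆[ℂ] ℂ := (cup σ s).compl₂ (hodge σ s)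

/-- `B(h,h') = C(h,∗h')` by definition (third clause of (2.7)). -/
theorem form_apply' (σ : ι → ι) (s : ι → ℂ) (f g : ι →₀ ℂ) :
    form σ s f g = cup σ s f (hodge σ s g) := rfl

/-- `B(f,g) = Σ_k f(k) conj (g(k))`. -/
theorem form_apply {σ : ι → ι} (hσ : Function.Involutive σ) {s : ι → ℂ}
    (hs : ∀ i, s i = 1 ∨ s i = -1) (f g : ι →₀ ℂ) :
    form σ s f g = ∑ k ∈ f.support, f k * starRingEnd ℂ (g k) := by
  rw [form_apply', cup_hodge hσ hs]

/-- `B` may be summed over any finite set containing the support of the first argument. -/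
theorem form_eq_sum {σ : ι → ι} (hσ : Function.Involutive σ) {s : ι → ℂ}
    (hs : ∀ i, s i = 1 ∨ s i = -1) {f : ι →₀ ℂ} (g : ι →₀ ℂ) {S : Finset ι} (hS : f.support ⊆ S) :
    form σ s f g = ∑ k ∈ S, f k * starRingEnd ℂ (g k) := by
  rw [form_apply hσ hs]
  exact Finset.sum_subset hS (fun k _ hk => by rw [Finsupp.notMem_support_iff.mp hk, zero_mul])

/-- `B(f,f) = Σ_k |f(k)|²`. -/
theorem form_self_re {σ : ι → ι} (hσ : Function.Involutive σ) {s : ι → ℂ}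
    (hs : ∀ i, s i = 1 ∨ s i = -1) (f : ι →₀ ℂ) :
    (form σ s f f).re = ∑ k ∈ f.support, Complex.normSq (f k) := by
  rw [form_apply hσ hs, Complex.re_sum]
  exact Finset.sum_congr rfl (fun k _ => by rw [Complex.mul_conj, Complex.ofReal_re])

/-- **`B` is positive definite** (fifth clause of (2.7)). -/
theorem posDef_form {σ : ι → ι} (hσ : Function.Involutive σ) {s : ι → ℂ}
    (hs : ∀ i, s i = 1 ∨ s i = -1) : PosDef (form σ s) := by
  intro f hf
  rw [form_self_re hσ hs]
  obtain ⟨i, hi⟩ : ∃ i, i ∈ f.support := by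
    by_contra h
    exact hf (Finsupp.support_eq_empty.mp (Finset.eq_empty_of_forall_notMem (by simpa using h)))
  exact Finset.sum_pos' (fun i _ => Complex.normSq_nonneg _)
    ⟨i, hi, Complex.normSq_pos.mpr (Finsupp.mem_support_iff.mp hi)⟩

/-- **`B` is Hermitian** (fourth clause of (2.7)): `B(g,f) = conj B(f,g)`. -/
theorem form_conj_symm {σ : ι → ι} (hσ : Function.Involutive σ) {s : ι → ℂ}
    (hs : ∀ i, s i = 1 ∨ s i = -1) (f g : ι →₀ ℂ) :
    form σ s g f = starRingEnd ℂ (form σ s f g) := by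
  classical
  rw [form_eq_sum hσ hs (S := f.support ∪ g.support) f Finset.subset_union_right,
    form_eq_sum hσ hs (S := f.support ∪ g.support) g Finset.subset_union_left, map_sum]
  exact Finset.sum_congr rfl (fun k _ => by rw [map_mul, Complex.conj_conj, mul_comm])

/-! ## The axioms for an operator diagonal in the standard basis -/

/-- A diagonal operator does not enlarge supports. -/
theorem support_subset_of_diag {w : ι → ℂ} {θ : End ℂ (ι →₀ ℂ)} (hθ : ∀ f i, θ f i = w i * f i)
    (f : ι →₀ ℂ) : (θ f).support ⊆ f.support := by
  intro i hi
  rw [Finsupp.mem_support_iff] at hi ⊢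
  intro h0
  exact hi (by rw [hθ, h0, mul_zero])

/-- **(2.5) holds unconditionally**: `θ` is a derivation for the cup form as soon as `σ`
exchanges the weights `w` and `1 - w` (`w(k) + w(σk) = 1` termwise; no other hypothesis). -/
theorem cupLeibniz_of_diag (σ : ι → ι) (s : ι → ℂ) {w : ι → ℂ}
    {θ : End ℂ (ι →₀ ℂ)} (hθ : ∀ f i, θ f i = w i * f i) (hw : ∀ i, w (σ i) = 1 - w i) :
    CupLeibniz θ (cup σ s) := by
  intro f g
  rw [cup_eq_sum σ s g (support_subset_of_diag hθ f), cup_apply, cup_apply,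
    ← Finset.sum_add_distrib]
  refine Finset.sum_congr rfl (fun k _ => ?_)
  rw [hθ, hθ, hw]
  ring

/-- **(2.6) holds unconditionally**: the cup form restricted to `H^{θ∼α} × H^{θ∼1-α}` (= functions
supported on the weight fibres of `α` and `1 - α`, hypothesis `hmem`) has trivial left and right
kernels, because `σ` is a bijection between the two fibres and `s ≠ 0` (test against the basis
vector `single (σ i) 1`). -/
theorem cupPerfect_of_diag {σ : ι → ι} (hσ : Function.Involutive σ) {s : ι → ℂ}
    (hs0 : ∀ i, s i ≠ 0) {w : ι → ℂ} {θ : End ℂ (ι →₀ ℂ)}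
    (hmem : ∀ (α : ℂ) (f : ι →₀ ℂ), f ∈ θ.maxGenEigenspace α ↔ ∀ i ∈ f.support, w i = α)
    (hw : ∀ i, w (σ i) = 1 - w i) : CupPerfect θ (cup σ s) := by
  classical
  intro α
  constructor
  · intro h₁ hh₁ horth
    rw [hmem] at hh₁
    ext i
    rw [Finsupp.coe_zero, Pi.zero_apply]
    by_contra hne
    have hi : i ∈ h₁.support := Finsupp.mem_support_iff.mpr hne
    have h2 : Finsupp.single (σ i) (1 : ℂ) ∈ θ.maxGenEigenspace (1 - α) := by
      rw [hmem]
      intro k hk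
      rw [Finset.mem_singleton.mp (Finsupp.support_single_subset hk), hw, hh₁ i hi]
    have h0 := horth _ h2
    rw [cup_apply, Finset.sum_eq_single i (fun k _ hki => ?_) (fun h => absurd hi h)] at h0
    · rw [Finsupp.single_eq_same, mul_one] at h0
      exact (mul_ne_zero hne (hs0 i)) h0
    · rw [Finsupp.single_apply, if_neg (fun h => hki (hσ.injective h).symm), mul_zero, mul_zero]
  · intro h₂ hh₂ horth
    rw [hmem] at hh₂
    ext j
    rw [Finsupp.coe_zero, Pi.zero_apply]
    by_contra hne
    have hj : j ∈ h₂.support := Finsupp.mem_support_iff.mpr hne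
    have h1 : Finsupp.single (σ j) (1 : ℂ) ∈ θ.maxGenEigenspace α := by
      rw [hmem]
      intro k hk
      rw [Finset.mem_singleton.mp (Finsupp.support_single_subset hk), hw, hh₂ j hj, sub_sub_cancel]
    have h0 := horth _ h1
    rw [cup_eq_sum σ s h₂ Finsupp.support_single_subset, Finset.sum_singleton,
      Finsupp.single_eq_same, one_mul, hσ j] at h0
    exact (mul_ne_zero (hs0 (σ j)) hne) h0

/-- **The one clause that is not bookkeeping.**  For a diagonal `θ`, the Hodge star of the signed
twist commutes with `θ` iff the weights satisfy `conj (w (σ j)) = w j` for every index `j`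
(test against `single (σ j) 1`). -/
theorem hodge_comm_iff {σ : ι → ι} (hσ : Function.Involutive σ) {s : ι → ℂ} (hs0 : ∀ i, s i ≠ 0)
    {w : ι → ℂ} {θ : End ℂ (ι →₀ ℂ)} (hθ : ∀ f i, θ f i = w i * f i) :
    (∀ g, hodge σ s (θ g) = θ (hodge σ s g)) ↔ ∀ j, starRingEnd ℂ (w (σ j)) = w j := by
  constructor
  · intro h j
    have hj := DFunLike.congr_fun (h (Finsupp.single (σ j) 1)) j
    rw [hodge_apply hσ, hθ, hθ, hodge_apply hσ, Finsupp.single_eq_same, map_mul, map_one, mul_one,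
      mul_one] at hj
    exact mul_left_cancel₀ (hs0 (σ j)) (hj.trans (mul_comm _ _))
  · intro h g
    ext j
    rw [hodge_apply hσ, hθ, hθ, hodge_apply hσ, map_mul, h j]
    ring

/-- **(2.7) ⟺ the weight condition.**  For a diagonal `θ` and the signed partner twist, Deninger's
complete axiom (2.7) — `∗∗ = -1`, `∗θ = θ∗`, `B = C(·,∗·)` Hermitian and positive definite — holds
iff `conj (w (σ j)) = w j` for all `j`; the four other clauses hold unconditionally
(`hodge_hodge`, `form_apply'`, `form_conj_symm`, `posDef_form`). -/
theorem hodgeStar_iff {σ : ι → ι} (hσ : Function.Involutive σ) {s : ι → ℂ}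
    (hs : ∀ i, s i = 1 ∨ s i = -1) (hsσ : ∀ i, s (σ i) = -s i) {w : ι → ℂ} {θ : End ℂ (ι →₀ ℂ)}
    (hθ : ∀ f i, θ f i = w i * f i) :
    HodgeStar θ (cup σ s) (hodge σ s) (form σ s) ↔ ∀ j, starRingEnd ℂ (w (σ j)) = w j := by
  have hs0 : ∀ i, s i ≠ 0 := fun i => by rcases hs i with h | h <;> simp [h]
  constructor
  · rintro ⟨-, hcomm, -, -, -⟩
    exact (hodge_comm_iff hσ hs0 hθ).1 hcomm
  · intro h
    exact ⟨hodge_hodge hσ hs hsσ, (hodge_comm_iff hσ hs0 hθ).2 h, fun f g => rfl,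
      fun f g => form_conj_symm hσ hs f g, posDef_form hσ hs⟩

/-- Under the weight condition the signed twist polarizes `θ` in the sense of the located-gap
entry ((2.7′) ∧ positivity), by Deninger's `polarized_of_hodgeStar`. -/
theorem polarized_of_weights {σ : ι → ι} (hσ : Function.Involutive σ) {s : ι → ℂ}
    (hs : ∀ i, s i = 1 ∨ s i = -1) (hsσ : ∀ i, s (σ i) = -s i) {w : ι → ℂ} {θ : End ℂ (ι →₀ ℂ)}
    (hθ : ∀ f i, θ f i = w i * f i) (hw : ∀ i, w (σ i) = 1 - w i)
    (h : ∀ j, starRingEnd ℂ (w (σ j)) = w j) : Polarized θ (form σ s) :=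
  polarized_of_hodgeStar (cupLeibniz_of_diag σ s hθ hw) ((hodgeStar_iff hσ hs hsσ hθ).2 h)

end Summit.RiemannHypothesis.RiemannHypothesis.Theorems.MotivicDoor.DeningerHodgeTwist
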